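import Mathlib.Analysis.Matrix.PosDef
import Mathlib.Analysis.Normed.Module.FiniteDimension
import Mathlib.Data.Real.Pointwise
import Mathlib.LinearAlgebra.Matrix.Block
import Mathlib.Topology.Instances.Matrix
import Mathlib.Topology.Semicontinuity.Basic
import HarnessLib

/-!
# Schur coordinates of positive definite forms: the concave functions `d_i`

Topic `NumberTheory/Automorphic` (reduction theory of positive forms); namespace
`Literature.NumberTheory.Automorphic`, grouping sub-namespace `PosForm`.  Definitions with bodies
and theorems; pure linear algebra over an `RCLike` field `𝕜`, no named fact, no `sorry`.

For a positive definite Hermitian matrix `P ∈ M_n(𝕜)` write `P = b bᴴ` with `b` upper triangular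
(Iwasawa / Cholesky coordinates of the symmetric space `GL_n / K`, the base point being the
identity form and `g` acting by `P ↦ g P gᴴ`).  The squared diagonal entries `|b_{ii}|²` — the
"root coordinates" of Siegel sets ([Borel1969, §1, §4]; [GetzHahn2024, §2.7 (2.16)–(2.17)]) — are
recovered from `P` WITHOUT coordinates as partial minima of the quadratic form:

  `d_i(P) = inf { Re (y* P y) : y_i = 1, y_j = 0 for j < i } = |b_{ii}|²`

(`schurDiag`, `schurDiag_mul_conjTranspose`; classically `d_i` is the Schur complement of the
lower-right block, the quotient of two principal minors).  Being an infimum of LINEAR functionals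
of `P`, `d_i` is super-additive and positively homogeneous (`schurDiag_add_le`, `schurDiag_smul`),
i.e. CONCAVE, bounded by the diagonal entry (`schurDiag_le_re_apply`), positive
(`schurDiag_pos`, by coercivity of positive definite forms, `exists_pos_mul_norm_sq_le_qf`) and
lower semicontinuous on the positive definite cone (`lowerSemicontinuous_schurDiag`), so that
super-level conditions `α(P) < d_i(P)` with `α` continuous (e.g. linear) cut out OPEN CONVEX
cones (`isOpen_setOf_lt_schurDiag`).  This is the linear algebra behind the convex bodies
sandwiched between two Siegel sets used to build equivariant good covers of the cone of positive
Humbert forms (sequel files).  Also recorded: the entries of `b bᴴ` (`mul_conjTranspose_apply'`,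
`re_mul_conjTranspose_apply_self`).

## References

* A. Borel, *Introduction aux groupes arithmétiques*, Hermann (1969), §1.2–1.4 (Siegel sets of
  `GL_n(ℝ)` in the `A N K` coordinates), §4. [Borel1969]
* J. R. Getz, H. Hahn, *An Introduction to Automorphic Representations*, GTM 300 (2024), §2.7.
  [GetzHahn2024]
* R. A. Horn, C. R. Johnson, *Matrix Analysis* (2nd ed. 2013), Thm. 7.7.7 / §7.7 Problem 13
  (variational characterisation of the Schur complement). [folklore]
-/

noncomputable section

open Matrix
open scoped ComplexOrder Pointwise

namespace Literature.NumberTheory.Automorphic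

namespace PosForm

variable {𝕜 : Type*} [RCLike 𝕜] {n : ℕ}

/-! ### The real quadratic form of a matrix -/

/-- The real quadratic form `y ↦ Re (y* P y)` of a square matrix `P`. [folklore] -/
def qf (P : Matrix (Fin n) (Fin n) 𝕜) (y : Fin n → 𝕜) : ℝ :=
  RCLike.re (star y ⬝ᵥ (P *ᵥ y))

/-- Unfolding lemma for `qf`. [folklore] -/
theorem qf_def (P : Matrix (Fin n) (Fin n) 𝕜) (y : Fin n → 𝕜) :
    qf P y = RCLike.re (star y ⬝ᵥ (P *ᵥ y)) :=
  rfl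

/-- `qf` is additive in the matrix. [folklore] -/
theorem qf_add (P Q : Matrix (Fin n) (Fin n) 𝕜) (y : Fin n → 𝕜) :
    qf (P + Q) y = qf P y + qf Q y := by
  simp only [qf, add_mulVec, dotProduct_add, map_add]

/-- `qf` is homogeneous in the matrix for real scalars. [folklore] -/
theorem qf_smul (t : ℝ) (P : Matrix (Fin n) (Fin n) 𝕜) (y : Fin n → 𝕜) :
    qf (t • P) y = t * qf P y := by
  simp only [qf, smul_mulVec, dotProduct_smul, RCLike.smul_re]

/-- `qf` is subtractive in the matrix. [folklore] -/
theorem qf_sub (P Q : Matrix (Fin n) (Fin n) 𝕜) (y : Fin n → 𝕜) :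
    qf (P - Q) y = qf P y - qf Q y := by
  simp only [qf, sub_mulVec, dotProduct_sub, map_sub]

/-- `qf P 0 = 0`. [folklore] -/
theorem qf_zero_right (P : Matrix (Fin n) (Fin n) 𝕜) : qf P 0 = 0 := by
  simp [qf]

/-- `qf P (c • y) = |c|² qf P y`. [folklore] -/
theorem qf_smul_right (P : Matrix (Fin n) (Fin n) 𝕜) (c : 𝕜) (y : Fin n → 𝕜) :
    qf P (c • y) = ‖c‖ ^ 2 * qf P y := by
  simp only [qf, mulVec_smul, star_smul, smul_dotProduct, dotProduct_smul, smul_eq_mul]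
  rw [← mul_assoc, RCLike.star_def, RCLike.mul_conj, ← RCLike.ofReal_pow, RCLike.re_ofReal_mul]

/-- The quadratic form as a double sum. [folklore] -/
theorem qf_eq_sum (P : Matrix (Fin n) (Fin n) 𝕜) (y : Fin n → 𝕜) :
    qf P y = RCLike.re (∑ k, ∑ j, star (y j) * P j k * y k) := by
  rw [qf, dot_mulVec_eq_sum_sum]
  rfl

/-- The value of the quadratic form at a basis vector is the diagonal entry. [folklore] -/
theorem qf_single (P : Matrix (Fin n) (Fin n) 𝕜) (i : Fin n) :
    qf P (Pi.single i (1 : 𝕜)) = RCLike.re (P i i) := by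
  rw [qf, mulVec_single_one]
  have : star (Pi.single i (1 : 𝕜) : Fin n → 𝕜) = (Pi.single i (1 : 𝕜) : Fin n → 𝕜) := by
    rw [← Pi.single_star, star_one]
  rw [this, single_one_dotProduct]
  rfl

/-- On a positive semidefinite matrix the quadratic form is non-negative. [folklore] -/
theorem qf_nonneg {P : Matrix (Fin n) (Fin n) 𝕜} (hP : P.PosSemidef) (y : Fin n → 𝕜) :
    0 ≤ qf P y :=
  hP.re_dotProduct_nonneg y

/-- On a positive definite matrix the quadratic form is positive at non-zero vectors. [folklore] -/
theorem qf_pos {P : Matrix (Fin n) (Fin n) 𝕜} (hP : P.PosDef) {y : Fin n → 𝕜} (hy : y ≠ 0) :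
    0 < qf P y :=
  hP.re_dotProduct_pos hy

/-- Entrywise bound: if all entries of `M` have norm `≤ ε` then `|qf M y| ≤ n² ε ‖y‖²`. [folklore] -/
theorem abs_qf_le (M : Matrix (Fin n) (Fin n) 𝕜) {ε : ℝ} (hM : ∀ j k, ‖M j k‖ ≤ ε) (y : Fin n → 𝕜) :
    |qf M y| ≤ (n : ℝ) ^ 2 * ε * ‖y‖ ^ 2 := by
  rw [qf_eq_sum]
  refine (RCLike.abs_re_le_norm _).trans ?_
  calc ‖∑ k, ∑ j, star (y j) * M j k * y k‖
      ≤ ∑ k, ‖∑ j, star (y j) * M j k * y k‖ := norm_sum_le _ _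
    _ ≤ ∑ k, ∑ j, ‖star (y j) * M j k * y k‖ := Finset.sum_le_sum fun k _ => norm_sum_le _ _
    _ ≤ ∑ _k : Fin n, ∑ _j : Fin n, ‖y‖ * ε * ‖y‖ := by
        refine Finset.sum_le_sum fun k _ => Finset.sum_le_sum fun j _ => ?_
        rw [norm_mul, norm_mul, norm_star]
        exact mul_le_mul (mul_le_mul (norm_le_pi_norm y j) (hM j k) (norm_nonneg _)
          (norm_nonneg _)) (norm_le_pi_norm y k) (norm_nonneg _)
          (mul_nonneg (norm_nonneg _) ((norm_nonneg _).trans (hM j k)))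
    _ = (n : ℝ) ^ 2 * ε * ‖y‖ ^ 2 := by
        simp only [Finset.sum_const, Finset.card_univ, Fintype.card_fin, nsmul_eq_mul]
        ring

/-! ### Coercivity of positive definite forms -/

/-- **Coercivity.**  A positive definite form is bounded below by a positive multiple of the
squared (sup) norm: `δ ‖y‖² ≤ Re (y* P y)` (minimum over the compact unit sphere). [folklore] -/
theorem exists_pos_mul_norm_sq_le_qf {P : Matrix (Fin n) (Fin n) 𝕜} (hP : P.PosDef) :
    ∃ δ : ℝ, 0 < δ ∧ ∀ y : Fin n → 𝕜, δ * ‖y‖ ^ 2 ≤ qf P y := by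
  have hcont : Continuous (qf P) := by
    unfold qf
    exact RCLike.continuous_re.comp
      ((continuous_star.comp continuous_id).dotProduct
        (continuous_const.matrix_mulVec continuous_id))
  -- rescaling a non-zero vector to the unit sphere
  have hresc : ∀ y : Fin n → 𝕜, y ≠ 0 →
      ‖((‖y‖ : 𝕜)⁻¹ • y)‖ = 1 ∧ qf P y = ‖y‖ ^ 2 * qf P ((‖y‖ : 𝕜)⁻¹ • y) := by
    intro y hy
    have hny : ‖y‖ ≠ 0 := norm_ne_zero_iff.mpr hy
    refine ⟨?_, ?_⟩
    · rw [norm_smul, norm_inv, RCLike.norm_ofReal, abs_norm, inv_mul_cancel₀ hny]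
    · rw [qf_smul_right, norm_inv, RCLike.norm_ofReal, abs_norm, ← mul_assoc, inv_pow,
        mul_inv_cancel₀ (pow_ne_zero 2 hny), one_mul]
  by_cases hne : (Metric.sphere (0 : Fin n → 𝕜) 1).Nonempty
  · obtain ⟨y₀, hy₀, hmin⟩ :=
      (isCompact_sphere (0 : Fin n → 𝕜) 1).exists_isMinOn hne hcont.continuousOn
    have hy₀ne : y₀ ≠ 0 := by
      intro h
      rw [h, mem_sphere_zero_iff_norm, norm_zero] at hy₀
      exact zero_ne_one hy₀
    refine ⟨qf P y₀, qf_pos hP hy₀ne, fun y => ?_⟩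
    by_cases hy : y = 0
    · rw [hy, norm_zero, qf_zero_right]; simp
    obtain ⟨h1, h2⟩ := hresc y hy
    have hle : qf P y₀ ≤ qf P ((‖y‖ : 𝕜)⁻¹ • y) := hmin (mem_sphere_zero_iff_norm.mpr h1)
    rw [h2, mul_comm]
    exact mul_le_mul_of_nonneg_left hle (sq_nonneg _)
  · refine ⟨1, one_pos, fun y => ?_⟩
    by_cases hy : y = 0
    · rw [hy, norm_zero, qf_zero_right]; simp
    exact absurd ⟨_, mem_sphere_zero_iff_norm.mpr (hresc y hy).1⟩ hne

/-! ### The pivot sets and the Schur coordinates `d_i` -/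

/-- The affine subspace `{y : y_i = 1, y_j = 0 for j < i}` over which `d_i` minimises. [folklore] -/
def pivotSet (i : Fin n) : Set (Fin n → 𝕜) :=
  {y | y i = 1 ∧ ∀ j, j < i → y j = 0}

/-- Membership in the pivot set. [folklore] -/
theorem mem_pivotSet_iff {i : Fin n} {y : Fin n → 𝕜} :
    y ∈ pivotSet i ↔ y i = 1 ∧ ∀ j, j < i → y j = 0 :=
  Iff.rfl

/-- The basis vector `e_i` lies in the `i`-th pivot set. [folklore] -/
theorem single_mem_pivotSet (i : Fin n) : (Pi.single i (1 : 𝕜)) ∈ pivotSet i :=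
  ⟨Pi.single_eq_same i 1, fun _ hj => Pi.single_eq_of_ne hj.ne 1⟩

/-- The pivot set is non-empty. [folklore] -/
theorem pivotSet_nonempty (i : Fin n) : (pivotSet (𝕜 := 𝕜) i).Nonempty :=
  ⟨_, single_mem_pivotSet i⟩

/-- A vector of the pivot set has norm at least `1`. [folklore] -/
theorem one_le_norm_of_mem_pivotSet {i : Fin n} {y : Fin n → 𝕜} (hy : y ∈ pivotSet i) :
    1 ≤ ‖y‖ := by
  have h := norm_le_pi_norm y i
  rwa [hy.1, norm_one] at h

/-- A vector of the pivot set is non-zero. [folklore] -/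
theorem ne_zero_of_mem_pivotSet {i : Fin n} {y : Fin n → 𝕜} (hy : y ∈ pivotSet i) : y ≠ 0 := by
  intro h
  have := hy.1
  rw [h, Pi.zero_apply] at this
  exact zero_ne_one this

/-- **The Schur coordinate `d_i(P)`**: the infimum of `Re (y* P y)` over `y_i = 1`,
`y_j = 0 (j < i)` — the Schur complement of the lower-right block of `P`, i.e. `|b_{ii}|²` for
`P = b bᴴ` with `b` upper triangular (`schurDiag_mul_conjTranspose`).
[cite: Borel1969, §1.2–1.4] -/
def schurDiag (P : Matrix (Fin n) (Fin n) 𝕜) (i : Fin n) : ℝ :=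
  sInf (qf P '' pivotSet i)

/-- Unfolding lemma for `schurDiag`. [folklore] -/
theorem schurDiag_def (P : Matrix (Fin n) (Fin n) 𝕜) (i : Fin n) :
    schurDiag P i = sInf (qf P '' pivotSet i) :=
  rfl

/-- Lower bounds pass to `d_i`. [folklore] -/
theorem le_schurDiag {P : Matrix (Fin n) (Fin n) 𝕜} {i : Fin n} {a : ℝ}
    (h : ∀ y ∈ pivotSet i, a ≤ qf P y) : a ≤ schurDiag P i :=
  le_csInf ((pivotSet_nonempty i).image _) (by rintro _ ⟨y, hy, rfl⟩; exact h y hy)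

/-- `d_i` is a lower bound of the quadratic form on the pivot set, as soon as the form is bounded
below there. [folklore] -/
theorem schurDiag_le_qf_of_bddBelow {P : Matrix (Fin n) (Fin n) 𝕜} {i : Fin n}
    (hb : BddBelow (qf P '' pivotSet i)) {y : Fin n → 𝕜} (hy : y ∈ pivotSet i) :
    schurDiag P i ≤ qf P y :=
  csInf_le hb ⟨y, hy, rfl⟩

/-- A uniform lower bound on the pivot set bounds the image below. [folklore] -/
theorem bddBelow_of_forall_le {P : Matrix (Fin n) (Fin n) 𝕜} {i : Fin n} {a : ℝ}
    (h : ∀ y ∈ pivotSet i, a ≤ qf P y) : BddBelow (qf P '' pivotSet i) :=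
  ⟨a, by rintro _ ⟨y, hy, rfl⟩; exact h y hy⟩

/-- For positive semidefinite `P` the image of the pivot set is bounded below by `0`. [folklore] -/
theorem bddBelow_of_posSemidef {P : Matrix (Fin n) (Fin n) 𝕜} (hP : P.PosSemidef) (i : Fin n) :
    BddBelow (qf P '' pivotSet i) :=
  bddBelow_of_forall_le fun y _ => qf_nonneg hP y

/-- For positive semidefinite `P`, `d_i(P) ≤ Re (y* P y)` on the pivot set. [folklore] -/
theorem schurDiag_le_qf {P : Matrix (Fin n) (Fin n) 𝕜} (hP : P.PosSemidef) {i : Fin n}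
    {y : Fin n → 𝕜} (hy : y ∈ pivotSet i) : schurDiag P i ≤ qf P y :=
  schurDiag_le_qf_of_bddBelow (bddBelow_of_posSemidef hP i) hy

/-- `d_i(P) ≥ 0` for positive semidefinite `P`. [folklore] -/
theorem schurDiag_nonneg {P : Matrix (Fin n) (Fin n) 𝕜} (hP : P.PosSemidef) (i : Fin n) :
    0 ≤ schurDiag P i :=
  le_schurDiag fun y _ => qf_nonneg hP y

/-- **`d_i(P) ≤ Re P_{ii}`** (test vector `e_i`). [folklore] -/
theorem schurDiag_le_re_apply {P : Matrix (Fin n) (Fin n) 𝕜} (hP : P.PosSemidef) (i : Fin n) :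
    schurDiag P i ≤ RCLike.re (P i i) := by
  rw [← qf_single P i]
  exact schurDiag_le_qf hP (single_mem_pivotSet i)

/-- **`d_i > 0` on positive definite matrices**, quantitatively: a coercivity constant is a lower
bound. [folklore] -/
theorem le_schurDiag_of_coercive {P : Matrix (Fin n) (Fin n) 𝕜} {δ : ℝ} (hδ : 0 ≤ δ)
    (h : ∀ y : Fin n → 𝕜, δ * ‖y‖ ^ 2 ≤ qf P y) (i : Fin n) : δ ≤ schurDiag P i := by
  refine le_schurDiag fun y hy => le_trans ?_ (h y)
  have h1 : 1 ≤ ‖y‖ ^ 2 := one_le_pow₀ (one_le_norm_of_mem_pivotSet hy)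
  calc δ = δ * 1 := (mul_one δ).symm
    _ ≤ δ * ‖y‖ ^ 2 := mul_le_mul_of_nonneg_left h1 hδ

/-- **`d_i(P) > 0`** for positive definite `P`. [folklore] -/
theorem schurDiag_pos {P : Matrix (Fin n) (Fin n) 𝕜} (hP : P.PosDef) (i : Fin n) :
    0 < schurDiag P i := by
  obtain ⟨δ, hδ, h⟩ := exists_pos_mul_norm_sq_le_qf hP
  exact lt_of_lt_of_le hδ (le_schurDiag_of_coercive hδ.le h i)

/-! ### Concavity: super-additivity and homogeneity -/

/-- **Super-additivity**: `d_i(P) + d_i(Q) ≤ d_i(P + Q)` (an infimum of sums dominates the sum of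
the infima). [folklore] -/
theorem schurDiag_add_le {P Q : Matrix (Fin n) (Fin n) 𝕜} (hP : P.PosSemidef) (hQ : Q.PosSemidef)
    (i : Fin n) : schurDiag P i + schurDiag Q i ≤ schurDiag (P + Q) i :=
  le_schurDiag fun y hy => by
    rw [qf_add]
    exact add_le_add (schurDiag_le_qf hP hy) (schurDiag_le_qf hQ hy)

/-- **Positive homogeneity**: `d_i(t P) = t d_i(P)` for `t ≥ 0`. [folklore] -/
theorem schurDiag_smul {t : ℝ} (ht : 0 ≤ t) (P : Matrix (Fin n) (Fin n) 𝕜) (i : Fin n) :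
    schurDiag (t • P) i = t * schurDiag P i := by
  rw [schurDiag, schurDiag]
  have : qf (t • P) '' pivotSet i = t • (qf P '' pivotSet i) := by
    rw [← Set.image_smul, Set.image_image]
    refine Set.image_congr' fun y => ?_
    rw [qf_smul, smul_eq_mul]
  rw [this, Real.sInf_smul_of_nonneg ht, smul_eq_mul]

/-- **Concavity along segments**: for `0 ≤ a, b` the value at `a P + b Q` dominates the
combination of the values. [folklore] -/
theorem schurDiag_convex_comb_le {P Q : Matrix (Fin n) (Fin n) 𝕜} (hP : P.PosSemidef)
    (hQ : Q.PosSemidef) {a b : ℝ} (ha : 0 ≤ a) (hb : 0 ≤ b) (i : Fin n) :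
    a * schurDiag P i + b * schurDiag Q i ≤ schurDiag (a • P + b • Q) i :=
  le_schurDiag fun y hy => by
    rw [qf_add, qf_smul, qf_smul]
    exact add_le_add (mul_le_mul_of_nonneg_left (schurDiag_le_qf hP hy) ha)
      (mul_le_mul_of_nonneg_left (schurDiag_le_qf hQ hy) hb)

/-! ### Perturbation and lower semicontinuity -/

/-- **Perturbation.**  If `P` is coercive with constant `δ`, `Q` is entrywise `ε`-close to `P`
and `n² ε ≤ θ δ`, then `(1 - θ) Re (y* P y) ≤ Re (y* Q y)`. [folklore] -/
theorem sub_mul_qf_le_qf_of_forall_norm_sub_le {P Q : Matrix (Fin n) (Fin n) 𝕜} {δ θ ε : ℝ}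
    (hcoer : ∀ y : Fin n → 𝕜, δ * ‖y‖ ^ 2 ≤ qf P y) (hθ : 0 ≤ θ)
    (hQ : ∀ j k, ‖Q j k - P j k‖ ≤ ε) (hε : (n : ℝ) ^ 2 * ε ≤ θ * δ) (y : Fin n → 𝕜) :
    (1 - θ) * qf P y ≤ qf Q y := by
  have h1 : qf Q y = qf P y + qf (Q - P) y := by rw [← qf_add, add_sub_cancel]
  have h2 : |qf (Q - P) y| ≤ (n : ℝ) ^ 2 * ε * ‖y‖ ^ 2 := abs_qf_le _ (fun j k => hQ j k) y
  have h3 : -((n : ℝ) ^ 2 * ε * ‖y‖ ^ 2) ≤ qf (Q - P) y := (abs_le.mp h2).1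
  have h4 : (n : ℝ) ^ 2 * ε * ‖y‖ ^ 2 ≤ θ * qf P y :=
    calc (n : ℝ) ^ 2 * ε * ‖y‖ ^ 2 ≤ θ * δ * ‖y‖ ^ 2 :=
          mul_le_mul_of_nonneg_right hε (sq_nonneg _)
      _ = θ * (δ * ‖y‖ ^ 2) := by ring
      _ ≤ θ * qf P y := mul_le_mul_of_nonneg_left (hcoer y) hθ
  rw [h1]
  linarith

/-- **Perturbation of `d_i`**: under the same hypotheses `(1 - θ) d_i(P) ≤ d_i(Q)`. [folklore] -/
theorem sub_mul_schurDiag_le_of_forall_norm_sub_le {P Q : Matrix (Fin n) (Fin n) 𝕜} {δ θ ε : ℝ}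
    (hP : P.PosSemidef) (hcoer : ∀ y : Fin n → 𝕜, δ * ‖y‖ ^ 2 ≤ qf P y) (hθ : 0 ≤ θ)
    (hθ1 : θ ≤ 1) (hQ : ∀ j k, ‖Q j k - P j k‖ ≤ ε) (hε : (n : ℝ) ^ 2 * ε ≤ θ * δ) (i : Fin n) :
    (1 - θ) * schurDiag P i ≤ schurDiag Q i :=
  le_schurDiag fun y hy =>
    le_trans (mul_le_mul_of_nonneg_left (schurDiag_le_qf hP hy) (sub_nonneg.mpr hθ1))
      (sub_mul_qf_le_qf_of_forall_norm_sub_le hcoer hθ hQ hε y)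

/-- **`d_i` is lower semicontinuous on the positive definite cone.** [folklore] -/
theorem lowerSemicontinuous_schurDiag (i : Fin n) :
    LowerSemicontinuous fun P : {P : Matrix (Fin n) (Fin n) 𝕜 // P.PosDef} => schurDiag P.1 i := by
  intro P₀ s hs
  obtain ⟨δ, hδ, hcoer⟩ := exists_pos_mul_norm_sq_le_qf P₀.2
  set d₀ : ℝ := schurDiag P₀.1 i with hd₀
  have hd₀pos : 0 < d₀ := schurDiag_pos P₀.2 i
  -- choose `θ ∈ (0, 1/2]` with `s < (1 - θ) d₀`
  set s' : ℝ := max s 0 with hs'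
  have hs'lt : s' < d₀ := max_lt hs hd₀pos
  set θ : ℝ := (d₀ - s') / (2 * d₀) with hθ
  have hθpos : 0 < θ := div_pos (sub_pos.mpr hs'lt) (by positivity)
  have hθle : θ ≤ 1 := by
    rw [hθ, div_le_one (by positivity)]
    linarith [le_max_right s 0]
  have hsθ : s < (1 - θ) * d₀ := by
    have : (1 - θ) * d₀ = (d₀ + s') / 2 := by
      rw [hθ]; field_simp; ring
    rw [this]
    linarith [le_max_left s 0]
  -- the entrywise neighbourhood
  set ε : ℝ := θ * δ / ((n : ℝ) ^ 2 + 1) with hε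
  have hεpos : 0 < ε := div_pos (mul_pos hθpos hδ) (by positivity)
  have hεle : (n : ℝ) ^ 2 * ε ≤ θ * δ := by
    rw [hε, mul_div_assoc']
    rw [div_le_iff₀ (by positivity)]
    nlinarith [mul_pos hθpos hδ, sq_nonneg (n : ℝ)]
  have hopen : IsOpen {P : {P : Matrix (Fin n) (Fin n) 𝕜 // P.PosDef} |
      ∀ j k, ‖P.1 j k - P₀.1 j k‖ < ε} := by
    simp only [Set.setOf_forall]
    refine isOpen_iInter_of_finite fun j => isOpen_iInter_of_finite fun k => ?_
    exact isOpen_lt ((continuous_subtype_val.matrix_elem j k).sub continuous_const).norm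
      continuous_const
  have hmem : P₀ ∈ {P : {P : Matrix (Fin n) (Fin n) 𝕜 // P.PosDef} |
      ∀ j k, ‖P.1 j k - P₀.1 j k‖ < ε} := fun j k => by
    rw [sub_self, norm_zero]; exact hεpos
  filter_upwards [hopen.mem_nhds hmem] with P hP
  exact lt_of_lt_of_le hsθ (sub_mul_schurDiag_le_of_forall_norm_sub_le P₀.2.posSemidef hcoer
    hθpos.le hθle (fun j k => (hP j k).le) hεle i)

/-- **Super-level sets `{α < d_i}` are open** in the positive definite cone, for `α` continuous.
[folklore] -/
theorem isOpen_setOf_lt_schurDiag {α : {P : Matrix (Fin n) (Fin n) 𝕜 // P.PosDef} → ℝ}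
    (hα : Continuous α) (i : Fin n) :
    IsOpen {P : {P : Matrix (Fin n) (Fin n) 𝕜 // P.PosDef} | α P < schurDiag P.1 i} := by
  have h : LowerSemicontinuous fun P : {P : Matrix (Fin n) (Fin n) 𝕜 // P.PosDef} =>
      schurDiag P.1 i + -α P :=
    (lowerSemicontinuous_schurDiag i).add hα.neg.lowerSemicontinuous
  have := h.isOpen_preimage 0
  convert this using 1
  ext P
  simp only [Set.mem_setOf_eq, Set.mem_preimage, Set.mem_Ioi]
  constructor <;> intro hP <;> linarith

/-! ### Upper triangular matrices: `d_i(b bᴴ) = |b_{ii}|²` and the entries of `b bᴴ` -/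

section Triangular

variable (b : Matrix (Fin n) (Fin n) 𝕜)

/-- `Re (y* (b bᴴ) y) = ∑_k |(bᴴ y)_k|²`. [folklore] -/
theorem qf_mul_conjTranspose (y : Fin n → 𝕜) :
    qf (b * bᴴ) y = ∑ k, ‖(bᴴ *ᵥ y) k‖ ^ 2 := by
  rw [qf, ← mulVec_mulVec, dotProduct_mulVec]
  have h : star y ᵥ* b = star (bᴴ *ᵥ y) := by
    rw [star_mulVec, conjTranspose_conjTranspose]
  rw [h]
  simp only [dotProduct, Pi.star_apply, RCLike.star_def, RCLike.conj_mul, map_sum]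
  refine Finset.sum_congr rfl fun k _ => ?_
  rw [← RCLike.ofReal_pow, RCLike.ofReal_re]

/-- Entries of `b bᴴ`: `(b bᴴ)_{ij} = ∑_k b_{ik} conj(b_{jk})`. [folklore] -/
theorem mul_conjTranspose_apply' (i j : Fin n) :
    (b * bᴴ) i j = ∑ k, b i k * star (b j k) := by
  simp only [mul_apply, conjTranspose_apply]

/-- Diagonal entries of `b bᴴ`: `Re (b bᴴ)_{ii} = ∑_k |b_{ik}|²`. [folklore] -/
theorem re_mul_conjTranspose_apply_self (i : Fin n) :
    RCLike.re ((b * bᴴ) i i) = ∑ k, ‖b i k‖ ^ 2 := by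
  rw [mul_conjTranspose_apply', map_sum]
  refine Finset.sum_congr rfl fun k _ => ?_
  rw [RCLike.star_def, RCLike.mul_conj, ← RCLike.ofReal_pow, RCLike.ofReal_re]

variable {b}

/-- For `b` upper triangular and `y` in the `i`-th pivot set, `(bᴴ y)_i = conj (b_{ii})`.
[folklore] -/
theorem conjTranspose_mulVec_apply_self_of_mem_pivotSet (hb : b.BlockTriangular id) {i : Fin n}
    {y : Fin n → 𝕜} (hy : y ∈ pivotSet i) : (bᴴ *ᵥ y) i = star (b i i) := by
  rw [mulVec, dotProduct]
  rw [Finset.sum_eq_single i]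
  · rw [conjTranspose_apply, hy.1, mul_one]
  · intro j _ hji
    rcases lt_or_gt_of_ne hji with h | h
    · rw [hy.2 j h, mul_zero]
    · rw [conjTranspose_apply, hb h, star_zero, zero_mul]
  · intro h; exact absurd (Finset.mem_univ i) h

/-- For `b` upper triangular and `y` in the `i`-th pivot set, `(bᴴ y)_k = 0` for `k < i`.
[folklore] -/
theorem conjTranspose_mulVec_apply_of_lt_of_mem_pivotSet (hb : b.BlockTriangular id) {i k : Fin n}
    (hk : k < i) {y : Fin n → 𝕜} (hy : y ∈ pivotSet i) : (bᴴ *ᵥ y) k = 0 := by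
  rw [mulVec, dotProduct]
  refine Finset.sum_eq_zero fun j _ => ?_
  rcases lt_or_ge j i with h | h
  · rw [hy.2 j h, mul_zero]
  · rw [conjTranspose_apply, hb (lt_of_lt_of_le hk h), star_zero, zero_mul]

/-- **Lower bound**: for `b` upper triangular, `|b_{ii}|² ≤ Re (y* b bᴴ y)` on the `i`-th pivot
set. [cite: Borel1969, §1.2–1.4] -/
theorem norm_sq_le_qf_mul_conjTranspose (hb : b.BlockTriangular id) {i : Fin n} {y : Fin n → 𝕜}
    (hy : y ∈ pivotSet i) : ‖b i i‖ ^ 2 ≤ qf (b * bᴴ) y := by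
  rw [qf_mul_conjTranspose]
  have h := Finset.single_le_sum (f := fun k => ‖(bᴴ *ᵥ y) k‖ ^ 2) (fun k _ => sq_nonneg _)
    (Finset.mem_univ i)
  rwa [conjTranspose_mulVec_apply_self_of_mem_pivotSet hb hy, norm_star] at h

/-- On upper triangular matrices the diagonal is multiplicative. [folklore] -/
private theorem upper_mul_apply_self {M N : Matrix (Fin n) (Fin n) 𝕜} (hM : M.BlockTriangular id)
    (hN : N.BlockTriangular id) (i : Fin n) : (M * N) i i = M i i * N i i := by
  rw [Matrix.mul_apply]
  refine Finset.sum_eq_single i (fun k _ hki => ?_) fun h => absurd (Finset.mem_univ i) h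
  rcases lt_or_gt_of_ne hki with h | h
  · rw [hM h, zero_mul]
  · rw [hN h, mul_zero]

/-- An upper triangular matrix with non-zero diagonal is invertible. [folklore] -/
theorem isUnit_det_of_upperTriangular (hb : b.BlockTriangular id) (hd : ∀ i, b i i ≠ 0) :
    IsUnit b.det := by
  rw [det_of_upperTriangular hb, isUnit_iff_ne_zero]
  exact Finset.prod_ne_zero_iff.mpr fun i _ => hd i

/-- **`d_i(b bᴴ) = |b_{ii}|²`** for `b` upper triangular with non-zero diagonal entries: the lower
bound `norm_sq_le_qf_mul_conjTranspose` is attained at `y = (b⁻¹)ᴴ (conj b_{ii} · e_i)`, which lies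
in the pivot set because `b⁻¹` is upper triangular with `(b⁻¹)_{ii} b_{ii} = 1`.
[cite: Borel1969, §1.2–1.4] -/
theorem schurDiag_mul_conjTranspose (hb : b.BlockTriangular id) (hd : ∀ i, b i i ≠ 0) (i : Fin n) :
    schurDiag (b * bᴴ) i = ‖b i i‖ ^ 2 := by
  have hdet : IsUnit b.det := isUnit_det_of_upperTriangular hb hd
  haveI : Invertible b := invertibleOfIsUnitDet b hdet
  have hbinv : b⁻¹.BlockTriangular id := blockTriangular_inv_of_blockTriangular hb
  -- the minimiser
  set y : Fin n → 𝕜 := (b⁻¹)ᴴ *ᵥ Pi.single i (star (b i i)) with hy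
  have hby : bᴴ *ᵥ y = Pi.single i (star (b i i)) := by
    rw [hy, mulVec_mulVec, ← conjTranspose_mul, nonsing_inv_mul _ hdet, conjTranspose_one,
      one_mulVec]
  have hdiag : b⁻¹ i i * b i i = 1 := by
    have h := upper_mul_apply_self hbinv hb i
    rwa [nonsing_inv_mul _ hdet, one_apply_eq, eq_comm] at h
  have hymem : y ∈ pivotSet i := by
    refine ⟨?_, fun j hj => ?_⟩
    · rw [hy, mulVec, dotProduct, Finset.sum_eq_single i]
      · rw [conjTranspose_apply, Pi.single_eq_same, ← star_mul, mul_comm, hdiag, star_one]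
      · intro k _ hki
        rw [Pi.single_eq_of_ne hki, mul_zero]
      · intro h; exact absurd (Finset.mem_univ i) h
    · rw [hy, mulVec, dotProduct, Finset.sum_eq_single i]
      · rw [conjTranspose_apply, hbinv hj, star_zero, zero_mul]
      · intro k _ hki
        rw [Pi.single_eq_of_ne hki, mul_zero]
      · intro h; exact absurd (Finset.mem_univ i) h
  have hval : qf (b * bᴴ) y = ‖b i i‖ ^ 2 := by
    rw [qf_mul_conjTranspose, hby, Finset.sum_eq_single i]
    · rw [Pi.single_eq_same, norm_star]
    · intro k _ hki
      rw [Pi.single_eq_of_ne hki, norm_zero, zero_pow two_ne_zero]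
    · intro h; exact absurd (Finset.mem_univ i) h
  refine le_antisymm ?_ (le_schurDiag fun z hz => norm_sq_le_qf_mul_conjTranspose hb hz)
  rw [← hval]
  exact schurDiag_le_qf_of_bddBelow
    (bddBelow_of_forall_le fun z hz => norm_sq_le_qf_mul_conjTranspose hb hz) hymem

/-- For `b` upper triangular, the terms `k < j` of `(b bᴴ)_{ij} = ∑_k b_{ik} conj(b_{jk})`
vanish. [folklore] -/
theorem mul_conjTranspose_apply_eq_sum_filter (hb : b.BlockTriangular id) (i j : Fin n) :
    (b * bᴴ) i j = ∑ k ∈ Finset.univ.filter (fun k => j ≤ k), b i k * star (b j k) := by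
  rw [mul_conjTranspose_apply', Finset.sum_filter]
  refine Finset.sum_congr rfl fun k _ => ?_
  split_ifs with h
  · rfl
  · rw [hb (lt_of_not_ge h), star_zero, mul_zero]

/-- **Entry bound**: for `b` upper triangular, `|(b bᴴ)_{ij}| ≤ ∑_{k ≥ j} |b_{ik}| |b_{jk}|`.
[folklore] -/
theorem norm_mul_conjTranspose_apply_le (hb : b.BlockTriangular id) (i j : Fin n) :
    ‖(b * bᴴ) i j‖ ≤ ∑ k ∈ Finset.univ.filter (fun k => j ≤ k), ‖b i k‖ * ‖b j k‖ := by
  rw [mul_conjTranspose_apply_eq_sum_filter hb]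
  refine (norm_sum_le _ _).trans (Finset.sum_le_sum fun k _ => ?_)
  rw [norm_mul, norm_star]

/-- **Diagonal entries**: for `b` upper triangular, `Re (b bᴴ)_{ii} = ∑_{k ≥ i} |b_{ik}|²`.
[folklore] -/
theorem re_mul_conjTranspose_apply_self_eq_sum_filter (hb : b.BlockTriangular id) (i : Fin n) :
    RCLike.re ((b * bᴴ) i i) = ∑ k ∈ Finset.univ.filter (fun k => i ≤ k), ‖b i k‖ ^ 2 := by
  rw [re_mul_conjTranspose_apply_self, Finset.sum_filter]
  refine Finset.sum_congr rfl fun k _ => ?_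
  split_ifs with h
  · rfl
  · rw [hb (lt_of_not_ge h), norm_zero, zero_pow two_ne_zero]

end Triangular

/-! ### Positive definite matrices form a convex cone -/

/-- A positive real multiple of a positive definite matrix is positive definite. [folklore] -/
theorem posDef_smul {P : Matrix (Fin n) (Fin n) 𝕜} (hP : P.PosDef) {t : ℝ} (ht : 0 < t) :
    (t • P).PosDef := by
  refine PosDef.of_dotProduct_mulVec_pos ?_ fun x hx => ?_
  · change (t • P)ᴴ = t • P
    rw [conjTranspose_smul, star_trivial, hP.1.eq]
  · have h := hP.dotProduct_mulVec_pos hx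
    rw [smul_mulVec, dotProduct_smul, RCLike.real_smul_eq_coe_mul]
    rw [RCLike.pos_iff] at h ⊢
    rw [RCLike.re_ofReal_mul, RCLike.im_ofReal_mul, h.2, mul_zero]
    exact ⟨mul_pos ht h.1, rfl⟩

/-- A non-negative real multiple of a positive semidefinite matrix is positive semidefinite.
[folklore] -/
theorem posSemidef_smul {P : Matrix (Fin n) (Fin n) 𝕜} (hP : P.PosSemidef) {t : ℝ} (ht : 0 ≤ t) :
    (t • P).PosSemidef := by
  refine PosSemidef.of_dotProduct_mulVec_nonneg ?_ fun x => ?_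
  · change (t • P)ᴴ = t • P
    rw [conjTranspose_smul, star_trivial, hP.1.eq]
  · have h := hP.dotProduct_mulVec_nonneg x
    rw [smul_mulVec, dotProduct_smul, RCLike.real_smul_eq_coe_mul]
    rw [RCLike.nonneg_iff] at h ⊢
    rw [RCLike.re_ofReal_mul, RCLike.im_ofReal_mul, h.2, mul_zero]
    exact ⟨mul_nonneg ht h.1, rfl⟩

/-- **The positive definite matrices form a convex cone.** [folklore] -/
theorem convex_setOf_posDef : Convex ℝ {P : Matrix (Fin n) (Fin n) 𝕜 | P.PosDef} := by
  intro P hP Q hQ a b ha hb hab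
  rcases ha.eq_or_lt with rfl | ha'
  · rw [zero_add] at hab
    rw [hab, zero_smul, zero_add, one_smul]
    exact hQ
  · exact (posDef_smul hP ha').add_posSemidef (posSemidef_smul hQ.posSemidef hb)

/-! ### Convexity of the super-level conditions -/

/-- **`{P ≻ 0 : ℓ(P) < d_i(P)}` is convex** for `ℓ` real-linear. [folklore] -/
theorem convex_setOf_lt_schurDiag (ℓ : Matrix (Fin n) (Fin n) 𝕜 →ₗ[ℝ] ℝ) (i : Fin n) :
    Convex ℝ {P : Matrix (Fin n) (Fin n) 𝕜 | P.PosDef ∧ ℓ P < schurDiag P i} := by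
  intro P hP Q hQ a b ha hb hab
  refine ⟨convex_setOf_posDef hP.1 hQ.1 ha hb hab, ?_⟩
  have hconc := schurDiag_convex_comb_le hP.1.posSemidef hQ.1.posSemidef ha hb i
  rw [map_add, map_smul, map_smul, smul_eq_mul, smul_eq_mul]
  refine lt_of_lt_of_le ?_ hconc
  rcases ha.eq_or_lt with rfl | ha'
  · rw [zero_add] at hab
    rw [hab, zero_mul, zero_mul, zero_add, zero_add, one_mul, one_mul]
    exact hQ.2
  · exact add_lt_add_of_lt_of_le (mul_lt_mul_of_pos_left hP.2 ha')
      (mul_le_mul_of_nonneg_left hQ.2.le hb)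

/-- **`{P ≻ 0 : ‖ℓ(P)‖ < c d_i(P)}` is convex** for `ℓ` real-linear into a normed space and
`c ≥ 0`. [folklore] -/
theorem convex_setOf_norm_lt_mul_schurDiag {E : Type*} [SeminormedAddCommGroup E] [NormedSpace ℝ E]
    (ℓ : Matrix (Fin n) (Fin n) 𝕜 →ₗ[ℝ] E) {c : ℝ} (hc : 0 ≤ c) (i : Fin n) :
    Convex ℝ {P : Matrix (Fin n) (Fin n) 𝕜 | P.PosDef ∧ ‖ℓ P‖ < c * schurDiag P i} := by
  intro P hP Q hQ a b ha hb hab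
  refine ⟨convex_setOf_posDef hP.1 hQ.1 ha hb hab, ?_⟩
  have hconc := schurDiag_convex_comb_le hP.1.posSemidef hQ.1.posSemidef ha hb i
  rw [map_add, map_smul, map_smul]
  refine lt_of_lt_of_le ?_ (mul_le_mul_of_nonneg_left hconc hc)
  refine lt_of_le_of_lt (norm_add_le _ _) ?_
  rw [norm_smul, norm_smul, Real.norm_of_nonneg ha, Real.norm_of_nonneg hb, mul_add,
    mul_left_comm c a, mul_left_comm c b]
  rcases ha.eq_or_lt with rfl | ha'
  · rw [zero_add] at hab
    rw [hab, zero_mul, zero_mul, zero_add, zero_add, one_mul, one_mul]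
    exact hQ.2
  · exact add_lt_add_of_lt_of_le (mul_lt_mul_of_pos_left hP.2 ha')
      (mul_le_mul_of_nonneg_left hQ.2.le hb)

end PosForm

end Literature.NumberTheory.Automorphic
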